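import Summits.HubbardSuperconductivity.HubbardSuperconductivity.Theorems.AnisotropyChordKnnInterval32
import Summits.HubbardSuperconductivity.HubbardSuperconductivity.Theorems.AnisotropyChordKnnIntervalNeg23
import Summits.HubbardSuperconductivity.HubbardSuperconductivity.Theorems.AnisotropyChordKnnIntervalNeg26
import Summits.HubbardSuperconductivity.HubbardSuperconductivity.Theorems.AnisotropyChordKnnIntervalNeg28
import Summits.HubbardSuperconductivity.HubbardSuperconductivity.Theorems.AnisotropyChordKnnIntervalNeg30
import Summits.HubbardSuperconductivity.HubbardSuperconductivity.Theorems.AnisotropyChordKnnIntervalNeg32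
import Summits.HubbardSuperconductivity.HubbardSuperconductivity.Theorems.AnisotropyChordKnnIsotropic

/-!
# Route `AnisotropyChord` / H0 rotor rung, K_{n,n} sibling of XY-LM₀: **`XYLiebMattisKnn n Δ` for every `n ≤ 32` on the whole
# range `Δ ∈ [−4/5, 63/64]` and at `Δ = 1`** — the booked family «K_{n,n}, s ≤ 16» = theory seat THEOREM Q⁺'s certified range
# (memo ROTOR-THEORY-11 §166/§168: `n ≤ 32`, `Δ_t ∈ [−0.8, 1)`), minus the perturbative corner `(63/64, 1)`, KERNEL-CHECKED
(prover seat `hubbard-h0-rotor-p1` g13)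

Assembles the budget condition (S_M) for `η = 1 − Δ ∈ [1/64, 9/5]` from the thirteen interval tables (`xyICerts10 … xyICerts32`,
`xyICertsNeg23 … xyICertsNeg32`; ≈ 1 520 records, `decide +kernel`) and applies `xyLiebMattisKnn_of_budgets` (THEOREM Q + LEMMA R).
-/

set_option linter.dupNamespace false
set_option autoImplicit false

namespace Summit.HubbardSuperconductivity.HubbardSuperconductivity.Theorems.AnisotropyChord.Knn

/-- (S_M) for all `4 ≤ n ≤ 32`, `M + 4 ≤ n`, every real `η ∈ [1/64, 9/5]`. [folklore] -/
theorem budgetCondition_full_of_le_32 {n M : ℕ} (hn : n ≤ 32) (hM : M + 4 ≤ n) {η : ℝ}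
    (h1 : ((1 / 64 : ℚ) : ℝ) ≤ η) (h2 : η ≤ ((9 / 5 : ℚ) : ℝ)) : BudgetCondition n M η := by
  by_cases hη : η ≤ ((1 : ℚ) : ℝ)
  · exact budgetCondition_interval_of_le_32 hn hM h1 hη
  have hη1 : ((1 : ℚ) : ℝ) ≤ η := le_of_lt (not_le.mp hη)
  by_cases h16 : n ≤ 16
  · exact budgetCondition_interval_of_le_16 h16 hM h1 h2
  by_cases h18 : n ≤ 18
  · exact budgetCondition_of_icertsOK xyICerts18_ok (by omega) h18 hM h1 h2
  by_cases h20 : n ≤ 20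
  · exact budgetCondition_of_icertsOK xyICerts20_ok (by omega) h20 hM h1 h2
  by_cases h23 : n ≤ 23
  · exact budgetCondition_of_icertsOK xyICertsNeg23_ok (by omega) h23 hM hη1 h2
  by_cases h26 : n ≤ 26
  · exact budgetCondition_of_icertsOK xyICertsNeg26_ok (by omega) h26 hM hη1 h2
  by_cases h28 : n ≤ 28
  · exact budgetCondition_of_icertsOK xyICertsNeg28_ok (by omega) h28 hM hη1 h2
  by_cases h30 : n ≤ 30
  · exact budgetCondition_of_icertsOK xyICertsNeg30_ok (by omega) h30 hM hη1 h2
  · exact budgetCondition_of_icertsOK xyICertsNeg32_ok (by omega) hn hM hη1 h2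

/-- **THEOREM (XY-Lieb–Mattis ordering on `K_{n,n}`, all `n ≤ 32`, all `Δ ∈ [−4/5, 63/64]`, kernel-checked):** in the two-big-spin
Jacobi reduction `P_M(1−Δ)` of the spin-½ XXZ model on `K_{n,n}` (THEOREMS M12, definitional), `⟨S⃗²⟩` of the sector ground states is
non-decreasing in `|Sᶻ_tot|` for every `n ≤ 32` and every real `Δ` with `−4/5 ≤ Δ ≤ 63/64`; together with `xyLiebMattisKnn_one`
(`Δ = 1`) this is the theory seat's certified family (`n ≤ 32`, `Δ_t ∈ [−0.8, 1]`) minus the open corner `Δ ∈ (63/64, 1)`.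
Not a statement about tori or the Hubbard model. [conjecture: theory seat hubbard-h0-rotor-theory-1, cycle 12 — THEOREM Q⁺ decided
family; Lean proof here] -/
theorem xyLiebMattisKnn_full_of_le_32 {n : ℕ} (hn : n ≤ 32) {Δ : ℝ} (h1 : -(4 / 5 : ℝ) ≤ Δ) (h2 : Δ ≤ 63 / 64) :
    XYLiebMattisKnn n Δ := by
  apply xyLiebMattisKnn_of_budgets (by linarith)
  intro M hM
  exact budgetCondition_full_of_le_32 hn hM (by push_cast; linarith) (by push_cast; linarith)

end Summit.HubbardSuperconductivity.HubbardSuperconductivity.Theorems.AnisotropyChord.Knn
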